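import Literature.IUT.LogThetaLattice.GlobalLGPFrobenioidsRealifiedPlacesVsRealifyMod
import HarnessLib

/-!
# [IUTchI] Ex 3.5 (i) `Φ_{𝒞⊩_mod}`: the `e_v`-NORMALISED identification `Φ^ℝ(∗) ≃ (V(F) →₀ ℝ_{≥0})` that matches the
# layer-L1/L5 realification map `realifyMod` (PROOF-ONLY; the constructive companion of the `…VsRealifyMod` certificate)

S. Mochizuki, *Inter-universal Teichmüller theory I*, §3, Example 3.5 (i), kurims manuscript (May 2020) p. 84
([IUTchI] Ex 3.5 (i) p.84) [claim: Mochizuki2012, status: disputed]: "`Φ_{𝒞⊩_mod,v} ≅ ord(𝒪^▷_{(F_mod)_v})^pf ⊗ ℝ_{≥0}`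
… `p_v` determines an element `log⊢_mod(p_v) ∈ Φ_{𝒞⊩_mod,v}`" (`ord_v(p_v) = e_v`); Mochizuki, *The geometry of Frobenioids
I*, Ex. 6.3 p. 113 [cite: MochizukiFrdI2008, Ex. 6.3 p.113].

PROOF-ONLY (no `def`, no instance; abc-iut-w4-d073 gen 4).  `GlobalLGPFrobenioidsRealifiedPlacesVsRealifyMod.lean` certifies
that the layer-L6 coordinate identification `Prop37.FrakRlfCat.effDivAddEquivVal F : Φ^ℝ(∗) ≃+ (V(F) →₀ ℝ_{≥0})` (plain
reindexing; at `F_mod`: `effDivEquivPhiMod`) differs from the layer-L1/L5 realification map `EffArithDivisor.realifyMod F`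
(abc-iut-w4-d050; `[v] ↦ e_v⁻¹ ·` unit vector, so that `div_v(p_v) = e_v·[v] ↦ log⊢_mod(p_v)`) by the factor `e_v` at each
finite place.  THIS FILE shows that the discrepancy is ONLY a choice of coordinates on the L6 side: there is an additive
isomorphism `Θ : Φ^ℝ(∗) ≃+ (V(F) →₀ ℝ_{≥0})` — `effDivAddEquivVal` followed by the coordinate scaling `x_v ↦ e_v⁻¹ x_v` at the
finite places — under which the L6 route `Φ(F) → Φ(∗) → Φ^ℝ(∗)` (`effDivOfArith`, `realifyEff`) followed by `Θ` IS
`realifyMod` (`exists_effDivAddEquivVal_normalized_realifyMod`); in particular at the field of moduli of an initial Θ-datum the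
realified divisor `div_v(p_v) = e_v · [v]` goes to abc-iut-L5-t2's `logMod v` and the prime divisor `[v]` to `e_v⁻¹ • logMod v`
(`exists_effDivEquiv_phiMod_normalized_logMod`) — the print-faithful form of `effDivEquivPhiMod_delta` in t2's stated
convention.  Offered to the owners of `effDivEquivPhiMod` / `rhoLgp` as the repair target of finding F-w4d073g4-1 (their
call).  No new Prop fact; no statement of the paper is strengthened; no side is taken on [IUTchIII] Cor. 3.12.
-/

noncomputable section

namespace Literature.IUT.LogThetaLattice

namespace Prop37

namespace FrakRlfCat

open NumberField IsDedekindDomain GlobalFrobenioidModels Literature.AlgebraicGeometry.Frobenioids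
  Literature.IUT.HodgeTheaters
open scoped NNReal

variable (F : Type) [Field F] [NumberField F]

/-! ### Coordinate scalings of `V(F) →₀ ℝ_{≥0}` -/

/-- The coordinate scaling `f ↦ (v ↦ c_v · f_v)` (finitely supported functions), as an additive map built from
`Finsupp.liftAddHom`, evaluates coordinatewise. [folklore] -/
private theorem liftAddHom_singleAddHom_mulLeft_apply (c : Val F → ℝ≥0) (f : Val F →₀ ℝ≥0) (q : Val F) :
    (Finsupp.liftAddHom (fun v : Val F => (Finsupp.singleAddHom v).comp (AddMonoidHom.mulLeft (c v)))) f q =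
      c q * f q := by
  classical
  rw [Finsupp.liftAddHom_apply, Finsupp.sum_apply, Finsupp.sum]
  have hterm : ∀ v, ((Finsupp.singleAddHom v).comp (AddMonoidHom.mulLeft (c v))) (f v) q =
      (Finsupp.single v (c v * f v) : Val F →₀ ℝ≥0) q := fun _ => rfl
  simp_rw [hterm]
  rw [Finset.sum_eq_single q]
  · rw [Finsupp.single_eq_same]
  · intro v _ hvq
    rw [Finsupp.single_apply, if_neg hvq]
  · intro hq
    rw [Finsupp.notMem_support_iff.mp hq, mul_zero, Finsupp.single_eq_same]

/-- **Coordinate scalings by nowhere-vanishing weights are additive automorphisms of `V(F) →₀ ℝ_{≥0}`**: there is an additive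
isomorphism acting as `f ↦ (v ↦ c_v · f_v)`. [folklore] -/
private theorem exists_addEquiv_scale (c : Val F → ℝ≥0) (hc : ∀ v, c v ≠ 0) :
    ∃ S : (Val F →₀ ℝ≥0) ≃+ (Val F →₀ ℝ≥0), ∀ f q, S f q = c q * f q := by
  classical
  let up : (Val F →₀ ℝ≥0) →+ (Val F →₀ ℝ≥0) :=
    Finsupp.liftAddHom fun v : Val F => (Finsupp.singleAddHom v).comp (AddMonoidHom.mulLeft (c v))
  let down : (Val F →₀ ℝ≥0) →+ (Val F →₀ ℝ≥0) :=
    Finsupp.liftAddHom fun v : Val F => (Finsupp.singleAddHom v).comp (AddMonoidHom.mulLeft (c v)⁻¹)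
  have hup : ∀ f q, up f q = c q * f q := liftAddHom_singleAddHom_mulLeft_apply F c
  have hdown : ∀ f q, down f q = (c q)⁻¹ * f q := liftAddHom_singleAddHom_mulLeft_apply F (fun v => (c v)⁻¹)
  have h₁ : down.comp up = AddMonoidHom.id _ := by
    refine AddMonoidHom.ext fun f => Finsupp.ext fun q => ?_
    rw [AddMonoidHom.comp_apply, hdown, hup, ← mul_assoc, inv_mul_cancel₀ (hc q), one_mul, AddMonoidHom.id_apply]
  have h₂ : up.comp down = AddMonoidHom.id _ := by
    refine AddMonoidHom.ext fun f => Finsupp.ext fun q => ?_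
    rw [AddMonoidHom.comp_apply, hup, hdown, ← mul_assoc, mul_inv_cancel₀ (hc q), one_mul, AddMonoidHom.id_apply]
  exact ⟨AddMonoidHom.toAddEquiv up down h₁ h₂, hup⟩

/-! ### The `e_v`-normalised identification `Φ^ℝ(∗) ≃ (V(F) →₀ ℝ_{≥0})` -/

/-- **There is an additive isomorphism `Θ : Φ^ℝ(∗) ≃+ (V(F) →₀ ℝ_{≥0})` under which the L6 route `Φ(F) → Φ^ℝ(∗)` IS
the L1/L5 realification map `realifyMod`**: `Θ = ` (coordinate scaling by `e_v⁻¹` at finite `v`, `1` at archimedean `v`)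
`∘ effDivAddEquivVal`.  ([IUTchI] Ex 3.5 (i) p.84) [claim: Mochizuki2012, status: disputed] -/
theorem exists_effDivAddEquivVal_normalized_realifyMod :
    ∃ Θ : effDiv (ModelPlaces F) (fun _ => ℝ) nonnegModel ≃+ (Val F →₀ ℝ≥0),
      (∀ a : EffArithDivisor F, Θ (realifyEff F (effDivOfArith F a)) = EffArithDivisor.realifyMod F a) ∧
        (∀ (D : effDiv (ModelPlaces F) (fun _ => ℝ) nonnegModel) (w : InfinitePlace F),
          Θ D (Sum.inl w : Val F) = effDivAddEquivVal F D (Sum.inl w : Val F)) ∧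
        ∀ (D : effDiv (ModelPlaces F) (fun _ => ℝ) nonnegModel) (v : FinitePlace F),
          Θ D (Sum.inr v : Val F) = (absRamIdx F v : ℝ≥0)⁻¹ * effDivAddEquivVal F D (Sum.inr v : Val F) := by
  let c : Val F → ℝ≥0 := fun q => match q with
    | Sum.inl _ => 1
    | Sum.inr v => (absRamIdx F v : ℝ≥0)⁻¹
  have hc : ∀ q, c q ≠ 0 := by
    rintro (w | v)
    · exact one_ne_zero
    · exact inv_ne_zero (absRamIdx_cast_ne_zero F v)
  obtain ⟨S, hS⟩ := exists_addEquiv_scale F c hc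
  refine ⟨(effDivAddEquivVal F).trans S, fun a => ?_, fun D w => ?_, fun D v => ?_⟩
  · refine Finsupp.ext fun q => ?_
    rw [AddEquiv.trans_apply, hS]
    rcases q with w | v
    · change (1 : ℝ≥0) * _ = _
      rw [one_mul, effDivAddEquivVal_realifyEff_effDivOfArith_apply_inl_eq_realifyMod]
    · change ((absRamIdx F v : ℝ≥0))⁻¹ * _ = _
      rw [effDivAddEquivVal_realifyEff_effDivOfArith_apply_inr, realifyMod_apply_inr, mul_comm]
  · rw [AddEquiv.trans_apply, hS]
    exact one_mul _
  · rw [AddEquiv.trans_apply, hS]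

/-! ### At the field of moduli of an initial Θ-datum -/

section InitialTheta

variable {F₀ K Fbar : Type} [Field F₀] [NumberField F₀] [Field K] [NumberField K] [Algebra F₀ K] [Field Fbar]
  [Algebra F₀ Fbar] [Algebra K Fbar] {E : WeierstrassCurve F₀} [E.IsElliptic] {l : ℕ} {P : BadPlacePredicates K}
  (D : InitialThetaData F₀ K Fbar E l P)

/-- **The print-faithful `δ`-statement at `F_mod`, in abc-iut-L5-t2's convention `log⊢_mod(p_v) ↦ 1`**: there is an additive
isomorphism `Θ : Φ^ℝ(∗)(F_mod) ≃+ Φ_{𝒞⊩_mod} = D.PhiMod` compatible with `realifyMod` along the L6 route under which the realified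
divisor `div_v(p_v) = e_v · [v]` of `p_v` goes to `logMod v` and the realified PRIME DIVISOR `[v]` goes to `e_v⁻¹ • logMod v`
(`v` a finite place of `F_mod`). ([IUTchI] Ex 3.5 (i) p.84) [claim: Mochizuki2012, status: disputed] -/
theorem exists_effDivEquiv_phiMod_normalized_logMod :
    ∃ Θ : effDiv (ModelPlaces (fieldOfModuli E)) (fun _ => ℝ) nonnegModel ≃+ D.PhiMod,
      (∀ a : EffArithDivisor (fieldOfModuli E),
          Θ (realifyEff (fieldOfModuli E) (effDivOfArith (fieldOfModuli E) a)) =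
            EffArithDivisor.realifyMod (fieldOfModuli E) a) ∧
        (∀ v : FinitePlace (fieldOfModuli E),
          Θ (realifyEff (fieldOfModuli E) (effDivOfArith (fieldOfModuli E)
              ((Finsupp.single v (absRamIdx (fieldOfModuli E) v), 0) : EffArithDivisor (fieldOfModuli E)))) =
            D.logMod (Sum.inr v)) ∧
        ∀ v : FinitePlace (fieldOfModuli E),
          Θ (realifyEff (fieldOfModuli E) (effDivOfArith (fieldOfModuli E)
              ((Finsupp.single v 1, 0) : EffArithDivisor (fieldOfModuli E)))) =
            (absRamIdx (fieldOfModuli E) v : ℝ≥0)⁻¹ • D.logMod (Sum.inr v) := by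
  obtain ⟨Θ, hΘ, -, -⟩ := exists_effDivAddEquivVal_normalized_realifyMod (fieldOfModuli E)
  refine ⟨Θ, hΘ, fun v => ?_, fun v => ?_⟩
  · rw [hΘ]
    exact realifyMod_logMod D v
  · rw [hΘ, realifyMod_single_inr]
    change _ = (absRamIdx (fieldOfModuli E) v : ℝ≥0)⁻¹ • Finsupp.single (Sum.inr v) (1 : ℝ≥0)
    rw [Finsupp.smul_single, smul_eq_mul, mul_one]
    rfl

end InitialTheta

/-! ### Uniqueness: the normalised identification is THE one compatible with `realifyMod` (appended) -/

section Unique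

variable (F : Type) [Field F] [NumberField F]

/-- An additive endomorphism of `V(F) →₀ ℝ_{≥0}` fixing every unit vector is the identity (each coordinate of
`t ↦ e (single v t)` is an additive self-map of `ℝ_{≥0}`, hence a homothety). [folklore] -/
private theorem addMonoidHom_eq_id_of_fixes_single (e : (Val F →₀ ℝ≥0) →+ (Val F →₀ ℝ≥0))
    (h : ∀ v : Val F, e (Finsupp.single v 1) = Finsupp.single v 1) : e = AddMonoidHom.id _ := by
  classical
  refine Finsupp.addHom_ext fun v x => Finsupp.ext fun w => ?_
  have hlin := addMonoidHom_nnreal_apply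
    ((Finsupp.applyAddHom w).comp (e.comp (Finsupp.singleAddHom v))) x
  simp only [AddMonoidHom.comp_apply, Finsupp.singleAddHom_apply, Finsupp.applyAddHom_apply] at hlin
  rw [AddMonoidHom.id_apply, hlin, h v, Finsupp.single_apply, Finsupp.single_apply]
  split_ifs <;> simp

/-- **UNIQUENESS of the `e_v`-normalised identification**: two additive isomorphisms `Φ^ℝ(∗) ≃+ (V(F) →₀ ℝ_{≥0})` that
both carry the L6 route `realifyEff ∘ effDivOfArith` of every `a ∈ Φ(F)` to `realifyMod a` are EQUAL (their quotient fixes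
`realifyMod(div_v(p_v))` and `realifyMod(1_w)`, i.e. every unit vector).  So the `Θ` of
`exists_effDivAddEquivVal_normalized_realifyMod` is canonical. ([IUTchI] Ex 3.5 (i) p.84) [claim: Mochizuki2012, status: disputed] -/
theorem effDivAddEquivVal_normalized_unique
    {Θ₁ Θ₂ : effDiv (ModelPlaces F) (fun _ => ℝ) nonnegModel ≃+ (Val F →₀ ℝ≥0)}
    (h₁ : ∀ a : EffArithDivisor F, Θ₁ (realifyEff F (effDivOfArith F a)) = EffArithDivisor.realifyMod F a)
    (h₂ : ∀ a : EffArithDivisor F, Θ₂ (realifyEff F (effDivOfArith F a)) = EffArithDivisor.realifyMod F a) :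
    Θ₁ = Θ₂ := by
  classical
  -- the quotient `Θ₂ ∘ Θ₁⁻¹` fixes the image of `realifyMod`
  have hfix : ∀ a : EffArithDivisor F,
      (Θ₁.symm.trans Θ₂) (EffArithDivisor.realifyMod F a) = EffArithDivisor.realifyMod F a := by
    intro a
    have hsymm : Θ₁.symm (EffArithDivisor.realifyMod F a) = realifyEff F (effDivOfArith F a) := by
      rw [AddEquiv.symm_apply_eq]
      exact (h₁ a).symm
    rw [AddEquiv.trans_apply, hsymm, h₂ a]
  -- hence every unit vector
  have hunit : ∀ v : Val F,
      (Θ₁.symm.trans Θ₂).toAddMonoidHom (Finsupp.single v 1) = Finsupp.single v 1 := by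
    rintro (w | u)
    · have h := hfix (0, Pi.single w 1)
      rw [realifyMod_arch_single] at h
      exact h
    · have h := hfix (Finsupp.single u (absRamIdx F u), 0)
      rw [realifyMod_single_absRamIdx] at h
      exact h
  have hid := addMonoidHom_eq_id_of_fixes_single F _ hunit
  refine AddEquiv.ext fun x => ?_
  have hx := DFunLike.congr_fun hid (Θ₁ x)
  rw [AddEquiv.coe_toAddMonoidHom, AddEquiv.trans_apply, AddEquiv.symm_apply_apply, AddMonoidHom.id_apply] at hx
  exact hx.symm

/-- **`∃!`**: there is EXACTLY ONE additive isomorphism `Φ^ℝ(∗) ≃+ (V(F) →₀ ℝ_{≥0})` under which the L6 route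
`Φ(F) → Φ^ℝ(∗)` is the L1/L5 realification map `realifyMod` — the `e_v`-normalised one.
([IUTchI] Ex 3.5 (i) p.84) [claim: Mochizuki2012, status: disputed] -/
theorem existsUnique_effDivAddEquivVal_normalized_realifyMod :
    ∃! Θ : effDiv (ModelPlaces F) (fun _ => ℝ) nonnegModel ≃+ (Val F →₀ ℝ≥0),
      ∀ a : EffArithDivisor F, Θ (realifyEff F (effDivOfArith F a)) = EffArithDivisor.realifyMod F a := by
  obtain ⟨Θ, hΘ, -, -⟩ := exists_effDivAddEquivVal_normalized_realifyMod F
  exact ⟨Θ, hΘ, fun Θ' hΘ' => effDivAddEquivVal_normalized_unique F hΘ' hΘ⟩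

/-- In particular the UN-normalised coordinate identification `effDivAddEquivVal` of the tree is NOT compatible with
`realifyMod` along the L6 route as soon as `F` has a finite place ramified over `ℚ` (cf. `…_single_inr_ne_realifyMod`).
([IUTchI] Ex 3.5 (i) p.84) [claim: Mochizuki2012, status: disputed] -/
theorem effDivAddEquivVal_not_compatible_of_ramified {w : FinitePlace F} (hw : absRamIdx F w ≠ 1) :
    ¬ ∀ a : EffArithDivisor F,
      effDivAddEquivVal F (realifyEff F (effDivOfArith F a)) = EffArithDivisor.realifyMod F a :=
  fun h => effDivAddEquivVal_realifyEff_effDivOfArith_single_inr_ne_realifyMod F hw (h _)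

end Unique

/-! ### Consequence for `†ρ_{lgp,v}` (`rhoLgp`) on the prime divisor `[v]` (appended) -/

section RhoLgp

variable {F₀ K Fbar : Type} [Field F₀] [NumberField F₀] [Field K] [NumberField K] [Algebra F₀ K] [Field Fbar]
  [Algebra F₀ Fbar] [Algebra K Fbar] {E : WeierstrassCurve F₀} [E.IsElliptic] {l : ℕ} {P : BadPlacePredicates K}
  (D : InitialThetaData F₀ K Fbar E l P)

/-- **The typed `†ρ_{lgp,v}` (`rhoLgp`, built on the UN-normalised `effDivEquivPhiMod`) sends the realified prime divisor
`[v]` of `F_mod` (`v` the place of `F_mod` under `w ∈ V(K)`) to `ρ`'s scalar `[K_w : (F_mod)_v]⁻¹` itself** — the value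
abc-iut-L5-t2's `ρ_w` assigns to `log⊢_mod(p_v) = e_v·[v]`. ([IUTchI] Ex 3.5 (i) p.84) [claim: Mochizuki2012, status: disputed] -/
theorem toAdd_rhoLgp_primeDivisor (w : Val K) (v : FinitePlace (fieldOfModuli E))
    (hw : toVMod F₀ K E w = Sum.inr v) :
    Multiplicative.toAdd (rhoLgp D w (Multiplicative.ofAdd (realifyEff (fieldOfModuli E)
        (effDivOfArith (fieldOfModuli E) ((Finsupp.single v 1, 0) : EffArithDivisor (fieldOfModuli E)))))) =
      D.rhoScalar w := by
  rw [rhoLgp_ofAdd, hw]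
  change D.rho w (effDivAddEquivVal (fieldOfModuli E) _ (Sum.inr v)) = _
  rw [effDivAddEquivVal_realifyEff_effDivOfArith_apply_inr]
  change D.rhoScalar w * (((Finsupp.single v 1 : FinitePlace (fieldOfModuli E) →₀ ℕ) v : ℕ) : ℝ≥0) = _
  rw [Finsupp.single_eq_same, Nat.cast_one, mul_one]

/-- **… whereas through ANY identification compatible with `realifyMod` (the `e_v`-normalised one) the same element has
`v`-coordinate `e_v⁻¹`, so `ρ_w` gives `[K_w : (F_mod)_v]⁻¹ · e_v⁻¹`** — print's «`log⊢_mod(p_v) ↦ [K_v:(F_mod)_v]⁻¹ log_Φ(p_v)`»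
read on `[v] = e_v⁻¹ · log⊢_mod(p_v)`.  The two values differ by `e_v` at every `v` ramified over `ℚ` (finding
F-w4d073g4-1, consequence clause, now in the kernel). ([IUTchI] Ex 3.5 (i) p.84) [claim: Mochizuki2012, status: disputed] -/
theorem rho_normalized_primeDivisor (w : Val K) (v : FinitePlace (fieldOfModuli E))
    (Θ : effDiv (ModelPlaces (fieldOfModuli E)) (fun _ => ℝ) nonnegModel ≃+ (Val (fieldOfModuli E) →₀ ℝ≥0))
    (hΘ : ∀ a : EffArithDivisor (fieldOfModuli E),
      Θ (realifyEff (fieldOfModuli E) (effDivOfArith (fieldOfModuli E) a)) = EffArithDivisor.realifyMod (fieldOfModuli E) a) :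
    D.rho w (Θ (realifyEff (fieldOfModuli E)
        (effDivOfArith (fieldOfModuli E) ((Finsupp.single v 1, 0) : EffArithDivisor (fieldOfModuli E)))) (Sum.inr v)) =
      D.rhoScalar w * (absRamIdx (fieldOfModuli E) v : ℝ≥0)⁻¹ := by
  rw [hΘ, realifyMod_apply_inr]
  change D.rhoScalar w * _ = _
  rw [Finsupp.single_eq_same, Nat.cast_one, one_mul]

end RhoLgp

end FrakRlfCat

end Prop37

end Literature.IUT.LogThetaLattice

end
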